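import Literature.AnabelianGeometry.AbsoluteAnabelian.MonoidKummerMapsTMLiftProofs
import Literature.AnabelianGeometry.AbsoluteAnabelian.MonoidKummerMapsTCGTorsorProofs
import Literature.AnabelianGeometry.AbsoluteAnabelian.AbsTopIII.UnitGroupCompactness
import HarnessLib

/-!
# [AbsTopIII] Prop 3.3 (ii): the `TCG` lifting statement REDUCED to the `TLG` lifting statement

Proof-only companion (theorems only, no new definitions) of `MonoidKummerMaps.lean` (seat
abc-iut-L4-t2; S. Mochizuki, *Topics in Absolute Anabelian Geometry III*, Def. 3.1 (i)(ii) pp. 66–67,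
Prop. 3.3 (ii) p. 74 with the author's Comments (2019) item (5); kurims manuscript, lit key
`paper:url-5493eb38cbb7`), in the format of abc-iut-L6-t21's `MonoidKummerMapsTMLiftProofs.lean`
(`TM` lifts from `TLG` lifts), whose unit-preservation theorem
`ModelMLFGaloisData.coe_map_mem_unitSubmonoid` (Rmk. 3.1.1 is Galois-theoretic) is the engine.

* `MLFClosure.one_add_mem_unitSubmonoid`, `MLFClosure.algEquiv_eq_one_of_forall_unitSubmonoid`,
  `ModelMLFGaloisData.tcgPair_actionKer` — `G_k` acts faithfully on `𝒪_k̄^×` (a non-unit integer `x`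
  has `1 + x` a unit), so the arithmetic kernel of the model `TCG`-pair is `Ker ε_k`;
* `ModelMLFGaloisData.exists_tcgPair_iso_of_tlgPair_iso` — an isomorphism of the model `TLG`-pairs
  RESTRICTS to an isomorphism of the model `TCG`-pairs `(Π ↷ 𝒪_k̄^×)` with the same Galois component;
* `tcgPairIso_lifts_of_model`, `tcgLifting_of_tlgLifting_relative`, `tcgLifting_of_tlgLifting` — the
  `TCG` lifting statement ("every admissible `Π ⥲ Π*` between MLF-Galois `TCG`-pairs lifts") FOLLOWS
  from the `TLG` lifting statement;
* `unitPairIsoFibresOfType_of_tlgLifting_relative`, `tcgPairIsoLiftsOfMonoAnalytic_of_tlgLifting` —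
  consequently (with `MonoidKummerMapsTCGTorsorProofs`: `Aut(μ_Ẑ) = Ẑ^×` is realised by equivariant
  automorphisms of `𝒪_k̄^×`) the corrected `TCG` clause of Prop. 3.3 (ii) and the mono-analytic `TCG`
  lifting fact `TCGPairIsoLiftsOfMonoAnalytic` ([IUTchII] Rmk. 1.11.1 (i)(b)) reduce to the ONE `TLG`
  lifting sentence — the local-class-field-theoretic input ([AbsAnab] Prop. 1.2.1), not addressed.

HONEST FRAMING: OUR kernel check of reductions between statements of refereed papers; nothing here
bears on [IUTchIII] Cor. 3.12.
-/

noncomputable section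

open scoped Classical

namespace Literature.AnabelianGeometry.AbsoluteAnabelian

open _root_.ValuativeRel
open Literature.NumberTheory.GaloisRepresentations (FiniteExtension.valuativeRel FiniteExtension.mem_integer_iff_isIntegral)

/-! ### §1. `G_k` acts faithfully on `𝒪_k̄^×` -/

section Faithful

variable (C : MLFClosure.{0})

/-- A non-zero integer of `k̄` which is not a unit becomes a unit after adding `1` (its valuation in
the local field `k(x)` is `< 1`). [cite: MochizukiAbsTopIII2015, Definition 3.1 (i) p.66] -/
theorem MLFClosure.one_add_mem_unitSubmonoid {x : C.K} (hx : x ∈ nonzeroIntegers C.k C.K)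
    (hxu : x ∉ unitSubmonoid C.k C.K) : 1 + x ∈ unitSubmonoid C.k C.K := by
  set E : IntermediateField C.k C.K := IntermediateField.adjoin C.k ({x} : Set C.K) with hE
  haveI : FiniteDimensional C.k E :=
    IntermediateField.adjoin.finiteDimensional (Algebra.IsIntegral.isIntegral x)
  letI := FiniteExtension.valuativeRel C.k E
  set z : E := IntermediateField.AdjoinSimple.gen C.k x with hz
  have hzx : (z : C.K) = x := rfl
  have hvz : valuation E z ≤ 1 := by
    rw [← Valuation.mem_integer_iff, FiniteExtension.mem_integer_iff_isIntegral C.k E]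
    exact (IntermediateField.isIntegral_coe_iff C.k C.K E z).mp
      ((mem_integersClosure_iff_isIntegral C.k C.K).mp hx.1)
  have hvz1 : valuation E z ≠ 1 := fun h =>
    hxu (hzx ▸ (C.mem_unitSubmonoid_iff_valuation_eq_one E z).mpr h)
  have h1 : valuation E (1 + z) = 1 := Valuation.map_one_add_of_lt _ (lt_of_le_of_ne hvz hvz1)
  have h2 := (C.mem_unitSubmonoid_iff_valuation_eq_one E (1 + z)).mpr h1
  have h3 : ((1 + z : E) : C.K) = 1 + x := by rw [IntermediateField.coe_add, IntermediateField.coe_one, hzx]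
  rwa [h3] at h2

/-- **`G_k` acts faithfully on `𝒪_k̄^×`**: a `k`-automorphism of `k̄` fixing every unit integer is the
identity. [cite: MochizukiAbsTopIII2015, Definition 3.1 (ii) p.67] -/
theorem MLFClosure.algEquiv_eq_one_of_forall_unitSubmonoid (σ : C.K ≃ₐ[C.k] C.K)
    (h : ∀ x : C.K, x ∈ unitSubmonoid C.k C.K → σ x = x) : σ = 1 := by
  refine C.algEquiv_eq_one_of_forall_nonzeroIntegers σ fun x hx => ?_
  by_cases hxu : x ∈ unitSubmonoid C.k C.K
  · exact h x hxu
  · have h1 := h (1 + x) (C.one_add_mem_unitSubmonoid hx hxu)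
    rw [map_add, map_one] at h1
    exact add_left_cancel h1

/-- For the model `TCG`-pair the arithmetic kernel is `Ker ε_k`.
[cite: MochizukiAbsTopIII2015, Definition 3.1 (ii) p.67] -/
theorem ModelMLFGaloisData.tcgPair_actionKer (D : ModelMLFGaloisData C.k C.K) :
    D.tcgPair.actionKer = D.aug.ker := by
  ext g
  rw [GaloisMonoidPair.mem_actionKer_iff, MonoidHom.mem_ker]
  constructor
  · intro h
    exact C.algEquiv_eq_one_of_forall_unitSubmonoid (D.aug g) fun x hx =>
      congrArg Subtype.val (h ⟨x, hx⟩)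
  · intro h x
    apply Subtype.ext
    show D.aug g • (x : C.K) = x
    rw [h, one_smul]

/-- A `TCG`-pair of mono-analytic type has trivial arithmetic kernel.
[cite: MochizukiAbsTopIII2015, Definition 3.1 (ii) p.67] -/
theorem GaloisMonoidPair.actionKer_eq_bot_of_isOfMonoAnalyticTypeMonoid_TCG (P : GaloisMonoidPair.{0})
    (hP : IsOfMonoAnalyticTypeMonoid .TCG P) : P.actionKer = ⊥ := by
  obtain ⟨C, D, Q, ⟨hbij, -⟩, hQ, ⟨ι⟩⟩ := hP.exists_model
  rw [ModelMLFGaloisData.monoidPair_TCG, Option.some.injEq] at hQ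
  subst hQ
  rw [← ι.map_actionKer, ModelMLFGaloisData.tcgPair_actionKer C D,
    (MonoidHom.ker_eq_bot_iff D.aug).mpr hbij.1, Subgroup.map_bot]

end Faithful

/-! ### §2. Restriction of `TLG`-isomorphisms to the unit groups -/

section ModelLift

variable {C₁ C₂ : MLFClosure.{0}} (D₁ : ModelMLFGaloisData C₁.k C₁.K) (D₂ : ModelMLFGaloisData C₂.k C₂.K)

/-- **Restriction.**  An isomorphism of the model `TLG`-pairs `(Π_{k₁} ↷ k̄₁^×) ⥲ (Π_{k₂} ↷ k̄₂^×)`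
restricts (units go to units, abc-iut-L6-t21's `coe_map_mem_unitSubmonoid`) to an isomorphism of the
model `TCG`-pairs `(Π_{k₁} ↷ 𝒪_{k̄₁}^×) ⥲ (Π_{k₂} ↷ 𝒪_{k̄₂}^×)` with the same Galois component.
[cite: MochizukiAbsTopIII2015, Proposition 3.3 (ii) p.74] -/
theorem ModelMLFGaloisData.exists_tcgPair_iso_of_tlgPair_iso
    (e' : GaloisMonoidPair.Iso D₁.tlgPair D₂.tlgPair) :
    ∃ e : GaloisMonoidPair.Iso D₁.tcgPair D₂.tcgPair, e.isoPi = e'.isoPi := by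
  set β := e'.isoM with hβdef
  set φ : D₁.Pi ≃ D₂.Pi := e'.isoPi.toMulEquiv.toEquiv with hφ
  have hβ : ∀ (g : D₁.Pi) (x : ↥(nonZeroDivisors C₁.K)),
      (β (g • x) : C₂.K) = D₂.aug (φ g) (β x : C₂.K) := fun g x =>
    congrArg Subtype.val (e'.smul_comm g x)
  have hβ' : ∀ (g : D₂.Pi) (z : ↥(nonZeroDivisors C₂.K)),
      (β.symm (g • z) : C₁.K) = D₁.aug (φ.symm g) (β.symm z : C₁.K) :=
    ModelMLFGaloisData.symm_equivariant φ β hβ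
  have hU : ∀ x : ↥(nonZeroDivisors C₁.K), (x : C₁.K) ∈ unitSubmonoid C₁.k C₁.K →
      (β x : C₂.K) ∈ unitSubmonoid C₂.k C₂.K :=
    ModelMLFGaloisData.coe_map_mem_unitSubmonoid φ β hβ
  have hU' : ∀ z : ↥(nonZeroDivisors C₂.K), (z : C₂.K) ∈ unitSubmonoid C₂.k C₂.K →
      (β.symm z : C₁.K) ∈ unitSubmonoid C₁.k C₁.K :=
    ModelMLFGaloisData.coe_map_mem_unitSubmonoid φ.symm β.symm hβ'
  -- the two inclusions `𝒪^× ↪ k̄^×`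
  have i₁ : ∀ x : ↥(unitSubmonoid C₁.k C₁.K), (x : C₁.K) ∈ nonZeroDivisors C₁.K := fun x =>
    mem_nonZeroDivisors_of_ne_zero (unitSubmonoid_le_nonzeroIntegers x.2).2
  have i₂ : ∀ z : ↥(unitSubmonoid C₂.k C₂.K), (z : C₂.K) ∈ nonZeroDivisors C₂.K := fun z =>
    mem_nonZeroDivisors_of_ne_zero (unitSubmonoid_le_nonzeroIntegers z.2).2
  let γ : ↥(unitSubmonoid C₁.k C₁.K) ≃* ↥(unitSubmonoid C₂.k C₂.K) :=
    { toFun := fun x => ⟨(β ⟨x, i₁ x⟩ : C₂.K), hU _ x.2⟩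
      invFun := fun z => ⟨(β.symm ⟨z, i₂ z⟩ : C₁.K), hU' _ z.2⟩
      left_inv := fun x => Subtype.ext (by
        show (β.symm ⟨(β ⟨x, i₁ x⟩ : C₂.K), _⟩ : C₁.K) = x
        rw [Subtype.coe_eta, MulEquiv.symm_apply_apply])
      right_inv := fun z => Subtype.ext (by
        show (β ⟨(β.symm ⟨z, i₂ z⟩ : C₁.K), _⟩ : C₂.K) = z
        rw [Subtype.coe_eta, MulEquiv.apply_symm_apply])
      map_mul' := fun x y => Subtype.ext (by
        have h : (⟨((x * y : ↥(unitSubmonoid C₁.k C₁.K)) : C₁.K), i₁ (x * y)⟩ :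
            ↥(nonZeroDivisors C₁.K)) = ⟨x, i₁ x⟩ * ⟨y, i₁ y⟩ := Subtype.ext rfl
        show (β ⟨((x * y : ↥(unitSubmonoid C₁.k C₁.K)) : C₁.K), i₁ (x * y)⟩ : C₂.K) =
          (β ⟨x, i₁ x⟩ : C₂.K) * (β ⟨y, i₁ y⟩ : C₂.K)
        rw [h, map_mul, Submonoid.coe_mul]) }
  refine ⟨⟨e'.isoPi, γ, fun g x => Subtype.ext ?_⟩, rfl⟩
  show (β ⟨D₁.aug g • (x : C₁.K), _⟩ : C₂.K) = D₂.aug (e'.isoPi g) • (β ⟨x, i₁ x⟩ : C₂.K)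
  have h1 : (⟨D₁.aug g • (x : C₁.K), i₁ (g • x)⟩ : ↥(nonZeroDivisors C₁.K)) = g • ⟨x, i₁ x⟩ :=
    Subtype.ext rfl
  rw [h1, hβ]
  rfl

end ModelLift

/-! ### §3. The `TCG` lifting statement from the `TLG` lifting statement -/

/-- **Core transfer (explicit models).**  Let `P ≅ (Π₁ ↷ 𝒪_{k̄₁}^×)` and `Q ≅ (Π₂ ↷ 𝒪_{k̄₂}^×)` be
`TCG`-pairs with chosen models, `f : Π_P ⥲ Π_Q` respecting the arithmetic quotients.  If every
admissible isomorphism `Π₁ ⥲ Π₂` lifts to an isomorphism of the model `TLG`-pairs, then `f` lifts to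
an isomorphism of pairs `P ⥲ Q`. [cite: MochizukiAbsTopIII2015, Proposition 3.3 (ii) p.74] -/
theorem tcgPairIso_lifts_of_model {C₁ C₂ : MLFClosure.{0}} (D₁ : ModelMLFGaloisData C₁.k C₁.K)
    (D₂ : ModelMLFGaloisData C₂.k C₂.K) {P Q : GaloisMonoidPair.{0}}
    (ι₁ : GaloisMonoidPair.Iso D₁.tcgPair P) (ι₂ : GaloisMonoidPair.Iso D₂.tcgPair Q)
    (f : P.Pi ≃ₜ* Q.Pi) (hf : P.actionKer.map f.toMulEquiv.toMonoidHom = Q.actionKer)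
    (hlift : ∀ f' : D₁.Pi ≃ₜ* D₂.Pi,
      D₁.tlgPair.actionKer.map f'.toMulEquiv.toMonoidHom = D₂.tlgPair.actionKer →
        ∃ e : GaloisMonoidPair.Iso D₁.tlgPair D₂.tlgPair, e.isoPi = f') :
    ∃ e : GaloisMonoidPair.Iso P Q, e.isoPi = f := by
  have hf'k : D₁.tlgPair.actionKer.map (ι₁.isoPi.trans (f.trans ι₂.isoPi.symm)).toMulEquiv.toMonoidHom =
      D₂.tlgPair.actionKer := by
    have hcomp : (ι₁.isoPi.trans (f.trans ι₂.isoPi.symm)).toMulEquiv.toMonoidHom =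
        ι₂.isoPi.symm.toMulEquiv.toMonoidHom.comp
          (f.toMulEquiv.toMonoidHom.comp ι₁.isoPi.toMulEquiv.toMonoidHom) :=
      MonoidHom.ext fun _ => rfl
    rw [ModelMLFGaloisData.tlgPair_actionKer C₁ D₁, ModelMLFGaloisData.tlgPair_actionKer C₂ D₂,
      ← ModelMLFGaloisData.tcgPair_actionKer C₁ D₁, ← ModelMLFGaloisData.tcgPair_actionKer C₂ D₂, hcomp,
      ← Subgroup.map_map, ← Subgroup.map_map, ι₁.map_actionKer, hf, ι₂.symm_map_actionKer]
  obtain ⟨e₀, he₀⟩ := hlift (ι₁.isoPi.trans (f.trans ι₂.isoPi.symm)) hf'k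
  obtain ⟨e₁, he₁⟩ := ModelMLFGaloisData.exists_tcgPair_iso_of_tlgPair_iso D₁ D₂ e₀
  rw [he₀] at he₁
  refine ⟨⟨f, ι₁.isoM.symm.trans (e₁.isoM.trans ι₂.isoM), fun g x => ?_⟩, rfl⟩
  show ι₂.isoM (e₁.isoM (ι₁.isoM.symm (g • x))) = f g • ι₂.isoM (e₁.isoM (ι₁.isoM.symm x))
  rw [GaloisMonoidPair.Iso.symm_smul_comm, e₁.smul_comm, ι₂.smul_comm, he₁]
  show ι₂.isoPi (ι₂.isoPi.symm (f (ι₁.isoPi (ι₁.isoPi.symm g)))) • _ = _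
  rw [ContinuousMulEquiv.apply_symm_apply, ContinuousMulEquiv.apply_symm_apply]

/-- **`TCG` lifting FROM `TLG` lifting — relative form.**  Let `HC`, `HL` be hypothesis predicates
("of hyperbolic orbicurve type" for `TCG`- resp. `TLG`-pairs) such that `HL` holds for the model
`TLG`-pair of any model data whose `TCG`-pair is isomorphic to a pair satisfying `HC`.  If every
admissible `Π ⥲ Π*` between MLF-Galois `TLG`-pairs satisfying `HL` lifts, then so does every
admissible `Π ⥲ Π*` between MLF-Galois `TCG`-pairs satisfying `HC`.
[cite: MochizukiAbsTopIII2015, Proposition 3.3 (ii) p.74] -/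
theorem tcgLifting_of_tlgLifting_relative (HC HL : GaloisMonoidPair.{0} → Prop)
    (hcompat : ∀ (C : MLFClosure.{0}) (D : ModelMLFGaloisData C.k C.K) (P : GaloisMonoidPair.{0}),
      Nonempty (GaloisMonoidPair.Iso D.tcgPair P) → HC P → HL D.tlgPair)
    (hlift : ∀ (P Q : GaloisMonoidPair.{0}), IsMLFGaloisMonoidPair .TLG P →
      IsMLFGaloisMonoidPair .TLG Q → HL P → HL Q → ∀ f : P.Pi ≃ₜ* Q.Pi,
        P.actionKer.map f.toMulEquiv.toMonoidHom = Q.actionKer →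
          ∃ e : GaloisMonoidPair.Iso P Q, e.isoPi = f)
    (P Q : GaloisMonoidPair.{0}) (hP : IsMLFGaloisMonoidPair .TCG P) (hQ : IsMLFGaloisMonoidPair .TCG Q)
    (hHP : HC P) (hHQ : HC Q) (f : P.Pi ≃ₜ* Q.Pi)
    (hf : P.actionKer.map f.toMulEquiv.toMonoidHom = Q.actionKer) :
    ∃ e : GaloisMonoidPair.Iso P Q, e.isoPi = f := by
  obtain ⟨C₁, D₁, P₁, hP₁, ⟨ι₁⟩⟩ := hP.exists_model
  obtain ⟨C₂, D₂, Q₂, hQ₂, ⟨ι₂⟩⟩ := hQ.exists_model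
  rw [ModelMLFGaloisData.monoidPair_TCG, Option.some.injEq] at hP₁ hQ₂
  subst hP₁
  subst hQ₂
  exact tcgPairIso_lifts_of_model D₁ D₂ ι₁ ι₂ f hf fun f' hf' =>
    hlift D₁.tlgPair D₂.tlgPair (isMLFGaloisMonoidPair_tlgPair C₁ D₁) (isMLFGaloisMonoidPair_tlgPair C₂ D₂)
      (hcompat C₁ D₁ P ⟨ι₁⟩ hHP) (hcompat C₂ D₂ Q ⟨ι₂⟩ hHQ) f' hf'

/-- **`TCG` lifting FROM the (hypothesis-free) `TLG` lifting statement.**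
[cite: MochizukiAbsTopIII2015, Proposition 3.3 (ii) p.74] -/
theorem tcgLifting_of_tlgLifting
    (hlift : ∀ (P Q : GaloisMonoidPair.{0}), IsMLFGaloisMonoidPair .TLG P →
      IsMLFGaloisMonoidPair .TLG Q → ∀ f : P.Pi ≃ₜ* Q.Pi,
        P.actionKer.map f.toMulEquiv.toMonoidHom = Q.actionKer →
          ∃ e : GaloisMonoidPair.Iso P Q, e.isoPi = f)
    (P Q : GaloisMonoidPair.{0}) (hP : IsMLFGaloisMonoidPair .TCG P) (hQ : IsMLFGaloisMonoidPair .TCG Q)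
    (f : P.Pi ≃ₜ* Q.Pi) (hf : P.actionKer.map f.toMulEquiv.toMonoidHom = Q.actionKer) :
    ∃ e : GaloisMonoidPair.Iso P Q, e.isoPi = f :=
  tcgLifting_of_tlgLifting_relative (fun _ => True) (fun _ => True) (fun _ _ _ _ _ => trivial)
    (fun P Q hP hQ _ _ f hf => hlift P Q hP hQ f hf) P Q hP hQ trivial trivial f hf

/-! ### §4. Consequences for the named `TCG` facts -/

/-- **The corrected Prop 3.3 (ii) surjectivity schema FROM `TLG` statements — relative form.**  If the
hypothesis predicate passes from `TCG`-pairs to the `TLG`-pairs of their model data, then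
`UnitPairIsoFibresOfType H` holds as soon as every admissible `Π ⥲ Π*` between `TLG`-pairs
satisfying `HL` lifts AND the `TLG` two-lift clause holds for `H` (both are consequences of ONE lift
per `f`: abc-iut-L6-t21's `MonoidKummerMapsUnitFibresProofs`); the `TCG` clause needs nothing else
(`MonoidKummerMapsTCGTorsorProofs`). [cite: MochizukiAbsTopIII2015, Proposition 3.3 (ii) p.74]
[cite: MochizukiAbsTopIIIComments2019, item (5)] -/
theorem unitPairIsoFibresOfType_of_tlgLifting_relative (H HL : GaloisMonoidPair.{0} → Prop)
    (hcompat : ∀ (C : MLFClosure.{0}) (D : ModelMLFGaloisData C.k C.K) (P : GaloisMonoidPair.{0}),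
      Nonempty (GaloisMonoidPair.Iso D.tcgPair P) → H P → HL D.tlgPair)
    (hlift : ∀ (P Q : GaloisMonoidPair.{0}), IsMLFGaloisMonoidPair .TLG P →
      IsMLFGaloisMonoidPair .TLG Q → HL P → HL Q → ∀ f : P.Pi ≃ₜ* Q.Pi,
        P.actionKer.map f.toMulEquiv.toMonoidHom = Q.actionKer →
          ∃ e : GaloisMonoidPair.Iso P Q, e.isoPi = f)
    (hTLG : ∀ (P Q : GaloisMonoidPair.{0}), IsMLFGaloisMonoidPair .TLG P → IsMLFGaloisMonoidPair .TLG Q →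
      H P → H Q →
      ∀ f : P.Pi ≃ₜ* Q.Pi, P.actionKer.map f.toMulEquiv.toMonoidHom = Q.actionKer →
        ∃ e₁ e₂ : GaloisMonoidPair.Iso P Q, e₁.isoPi = f ∧ e₂.isoPi = f ∧
        e₁.isoM ≠ e₂.isoM ∧ ∀ e : GaloisMonoidPair.Iso P Q, e.isoPi = f →
          (e.isoM = e₁.isoM ∨ e.isoM = e₂.isoM)) :
    UnitPairIsoFibresOfType H :=
  unitPairIsoFibresOfType_of_lifts H
    (fun P Q hP hQ hHP hHQ f hf =>
      tcgLifting_of_tlgLifting_relative H HL hcompat hlift P Q hP hQ hHP hHQ f hf) hTLG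

/-- **[IUTchII] Rmk 1.11.1 (i)(b) FROM the mono-analytic `TLG` lifting statement**: if every
`Π ⥲ Π*` between MLF-Galois `TLG`-pairs of mono-analytic type lifts to an isomorphism of pairs, then
`TCGPairIsoLiftsOfMonoAnalytic` holds (every `(f, u)` for `TCG`-pairs of mono-analytic type is
realised). [cite: Mochizuki2012, II Rmk 1.11.1 (i) p.50] -/
theorem tcgPairIsoLiftsOfMonoAnalytic_of_tlgLifting
    (hlift : ∀ (P Q : GaloisMonoidPair.{0}), IsMLFGaloisMonoidPair .TLG P → IsMLFGaloisMonoidPair .TLG Q →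
      IsOfMonoAnalyticTypeMonoid .TLG P → IsOfMonoAnalyticTypeMonoid .TLG Q →
      ∀ f : P.Pi ≃ₜ* Q.Pi, ∃ e : GaloisMonoidPair.Iso P Q, e.isoPi = f) :
    TCGPairIsoLiftsOfMonoAnalytic := by
  refine tcgPairIsoLiftsOfMonoAnalytic_of_exists_lift fun P Q _ _ hPm hQm f => ?_
  -- models with bijective open `ε_k`, whose `TLG`-pairs are then of mono-analytic type
  obtain ⟨C₁, D₁, P₁, hb₁, hP₁, ⟨ι₁⟩⟩ := hPm.exists_model
  obtain ⟨C₂, D₂, Q₂, hb₂, hQ₂, ⟨ι₂⟩⟩ := hQm.exists_model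
  rw [ModelMLFGaloisData.monoidPair_TCG, Option.some.injEq] at hP₁ hQ₂
  subst hP₁
  subst hQ₂
  have hf : P.actionKer.map f.toMulEquiv.toMonoidHom = Q.actionKer := by
    rw [GaloisMonoidPair.actionKer_eq_bot_of_isOfMonoAnalyticTypeMonoid_TCG P hPm,
      GaloisMonoidPair.actionKer_eq_bot_of_isOfMonoAnalyticTypeMonoid_TCG Q hQm, Subgroup.map_bot]
  have hL₁ : IsOfMonoAnalyticTypeMonoid .TLG D₁.tlgPair :=
    ⟨⟨C₁, D₁, D₁.tlgPair, hb₁, D₁.monoidPair_TLG, ⟨GaloisMonoidPair.Iso.refl _⟩⟩⟩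
  have hL₂ : IsOfMonoAnalyticTypeMonoid .TLG D₂.tlgPair :=
    ⟨⟨C₂, D₂, D₂.tlgPair, hb₂, D₂.monoidPair_TLG, ⟨GaloisMonoidPair.Iso.refl _⟩⟩⟩
  exact tcgPairIso_lifts_of_model D₁ D₂ ι₁ ι₂ f hf fun f' _ =>
    hlift D₁.tlgPair D₂.tlgPair (isMLFGaloisMonoidPair_tlgPair C₁ D₁) (isMLFGaloisMonoidPair_tlgPair C₂ D₂)
      hL₁ hL₂ f'

end Literature.AnabelianGeometry.AbsoluteAnabelian

end
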